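import Literature.Barriers.CriticalPhenomena.PlaquetteWalkIsthmusDefect
import Literature.Barriers.CriticalPhenomena.PlaquetteWalkYBCurveIdentityAllSpins
import HarnessLib

/-!
# Isthmus hole roots, Part 3e′: the hole defect laws at EVERY admissible spin — unconditionally

Rider on `PlaquetteWalkIsthmusDefect.lean` (Part 3, p368715) and `PlaquetteWalkYBCurveIdentityAllSpins.lean`
(F8, p366098) of the barrier catalogue (venture lane «pcv-sawmu», Tier B, seat b-step0). Part 3e proved the slot
relation, the slot reversal law, the hole defect law `VF_D(w.side σ, w) = 2·v·c_{σ̄}·t^{−4q}·X` and its modulus form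
for the complexified Yang–Baxter weights `ybCurve (−1) t r` at ANY spin `t` with `t¹⁶ = −1`, MODULO the curve identity
at that spin for outer roots (`CurveIdentityAt t r`). F8 proves exactly that identity
(`vertexFunctional_ybCurve_eq_zero_of_pow_sixteen`, Galois conjugation of the spin), so all four laws hold
unconditionally at the sixteen admissible spins: this file is the three-line discharge (`curveIdentityAt_of_pow_sixteen`)
and the unconditional restatements, plus the criterion `VF = 0 ↔ X = 0` (`v ≠ 0`) and a named statement
`PlaquetteWalkIsthmusDefectAllSpins`. (`DESIGN-next.md` item 3.)

References: A. Glazman, Electron. Commun. Probab. 20 (2015) no. 86, Lemma 3.1 (the `σ = ℓ/8` families)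
[Glazman2015WeightedSAW]; A. Glazman, I. Manolescu, arXiv:1708.00395v3, Lemma 2.1 [GlazmanManolescu2019];
H. Duminil-Copin, S. Smirnov, Ann. of Math. 175 (2012), proof of Lemma 1 [DuminilCopinSmirnov2012]. Status in print:
hole roots are outside every printed hypothesis — NEW-IN-WRITING (modest), as Part 3 (lit-2 g16).
-/

noncomputable section

open Real

namespace Literature.Barriers.CriticalPhenomena.PlaquetteWalk

open Literature.Probability.RandomPlanarGeometry.SAW.YangBaxter
open Literature.Probability.RandomPlanarGeometry.SAW.YangBaxter.MidEdge
open Literature.Probability.RandomPlanarGeometry.SAW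

section AllSpinsUnconditional

variable {t r : ℂ}

/-- **F8 discharges the curve identity at every admissible spin.** [cite: Glazman2015WeightedSAW, Lemma 3.1 (the σ = ℓ/8 families)] [cite: GlazmanManolescu2019, Lemma 2.1] -/
theorem curveIdentityAt_of_pow_sixteen (h16 : t ^ 16 = -1) (hr : r ≠ 0)
    (hD : t ^ 6 * (1 + r ^ 4) - (1 + t ^ 12) * r ^ 2 ≠ 0) : CurveIdentityAt t r :=
  fun L a hO f₀ hf => vertexFunctional_ybCurve_eq_zero_of_pow_sixteen h16 hr hD L a hO f₀ hf

/-- ★ **The slot relation at every admissible spin** (unconditional): at an isthmus hole root the two slot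
observables of `D ∖ {w}` satisfy `dc(σ̄, ℓ)·X + dc(σ̄, ℓ̄)·Y = 0`. [cite: GlazmanManolescu2019, Lemma 2.1] [cite: Glazman2015WeightedSAW, Lemma 3.1] -/
theorem slot_relation_of_pow_sixteen (h16 : t ^ 16 = -1) (hr : r ≠ 0)
    (hD : t ^ 6 * (1 + r ^ 4) - (1 + t ^ 12) * r ^ 2 ≠ 0) (Dl : List Face) (w : Face) (σ : Side)
    (hw : w ∈ Dl) (hh : nbr w σ ∉ dom Dl) (hO : OuterRoot (dom Dl) (w.side σ.opp)) :
    defectCoeff (ybCurve (-1) t r) t (oddCoeff r) σ.opp (lat σ) *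
        gmObservable (ybCurve (-1) t r) t (eraseFace Dl w) (w.side (lat σ)) (w.side (lat σ).opp) +
      defectCoeff (ybCurve (-1) t r) t (oddCoeff r) σ.opp (lat σ).opp *
        gmObservable (ybCurve (-1) t r) t (eraseFace Dl w) (w.side (lat σ).opp) (w.side (lat σ)) = 0 :=
  slot_relation_spin h16 (curveIdentityAt_of_pow_sixteen h16 hr hD) Dl w σ hw hh hO

/-- ★★ **The slot reversal law at every admissible spin** (unconditional, `v ≠ 0`): `Y = t^{−8q}·X`.
[cite: GlazmanManolescu2019, Lemma 2.1] [cite: Glazman2015WeightedSAW, Lemma 3.1] -/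
theorem gmObservable_slot_reverse_of_pow_sixteen (h16 : t ^ 16 = -1) (hr : r ≠ 0)
    (hD : t ^ 6 * (1 + r ^ 4) - (1 + t ^ 12) * r ^ 2 ≠ 0) (hv : ybV (-1) t r ≠ 0) (Dl : List Face) (w : Face)
    (σ : Side) (hw : w ∈ Dl) (hh : nbr w σ ∉ dom Dl) (hO : OuterRoot (dom Dl) (w.side σ.opp)) :
    gmObservable (ybCurve (-1) t r) t (eraseFace Dl w) (w.side (lat σ).opp) (w.side (lat σ)) =
      t ^ (-(8 : ℤ) * qTurn σ (lat σ)) *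
        gmObservable (ybCurve (-1) t r) t (eraseFace Dl w) (w.side (lat σ)) (w.side (lat σ).opp) :=
  gmObservable_slot_reverse_spin h16 hr hD (curveIdentityAt_of_pow_sixteen h16 hr hD) hv Dl w σ hw hh hO

/-- ★★★ **The hole defect law at every admissible spin** (unconditional): for every `t` with `t¹⁶ = −1`, every
good `r`, every finite face list and every isthmus hole root,
`VF_D(w.side σ, w) = 2·v·c_{σ̄}·t^{−4q}·G_{D∖w}(w.side ℓ → w.side ℓ̄)`.
[cite: GlazmanManolescu2019, Lemma 2.1] [cite: Glazman2015WeightedSAW, Lemma 3.1 (the σ = ℓ/8 families)] [cite: DuminilCopinSmirnov2012, proof of Lemma 1] -/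
theorem vertexFunctional_isthmus_root_eq_slot_of_pow_sixteen (h16 : t ^ 16 = -1) (hr : r ≠ 0)
    (hD : t ^ 6 * (1 + r ^ 4) - (1 + t ^ 12) * r ^ 2 ≠ 0) (Dl : List Face) (w : Face) (σ : Side)
    (hw : w ∈ Dl) (hh : nbr w σ ∉ dom Dl) (hO : OuterRoot (dom Dl) (w.side σ.opp)) :
    vertexFunctional (ybCurve (-1) t r) t (oddCoeff r) Dl (w.side σ) w =
      2 * ybV (-1) t r * oddCoeff r (slotIdx σ.opp) * t ^ (-(4 : ℤ) * qTurn σ (lat σ)) *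
        gmObservable (ybCurve (-1) t r) t (eraseFace Dl w) (w.side (lat σ)) (w.side (lat σ).opp) :=
  vertexFunctional_spin_isthmus_root_eq_slot h16 hr hD (curveIdentityAt_of_pow_sixteen h16 hr hD) Dl w σ hw hh hO

/-- ★★ **The modulus law at every admissible spin of modulus one** (unconditional): `‖VF‖ = 2‖v‖‖c_{σ̄}‖‖X‖`.
[cite: GlazmanManolescu2019, Lemma 2.1] [cite: Glazman2015WeightedSAW, Lemma 3.1] -/
theorem norm_vertexFunctional_isthmus_root_of_pow_sixteen (h16 : t ^ 16 = -1) (ht1 : ‖t‖ = 1) (hr : r ≠ 0)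
    (hD : t ^ 6 * (1 + r ^ 4) - (1 + t ^ 12) * r ^ 2 ≠ 0) (Dl : List Face) (w : Face) (σ : Side)
    (hw : w ∈ Dl) (hh : nbr w σ ∉ dom Dl) (hO : OuterRoot (dom Dl) (w.side σ.opp)) :
    ‖vertexFunctional (ybCurve (-1) t r) t (oddCoeff r) Dl (w.side σ) w‖ =
      2 * ‖ybV (-1) t r‖ * ‖oddCoeff r (slotIdx σ.opp)‖ *
        ‖gmObservable (ybCurve (-1) t r) t (eraseFace Dl w) (w.side (lat σ)) (w.side (lat σ).opp)‖ :=
  norm_vertexFunctional_spin_isthmus_root h16 ht1 hr hD (curveIdentityAt_of_pow_sixteen h16 hr hD) Dl w σ hw hh hO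

/-- The slot coefficient `c_{σ̄} ∈ {1, r, −1, −r}` is nonzero for `r ≠ 0`. [cite: GlazmanManolescu2019, Lemma 2.1, eq. (CR)] -/
private theorem oddCoeff_slotIdx_ne_zero (hr : r ≠ 0) (s : Side) : oddCoeff r (slotIdx s) ≠ 0 := by
  cases s <;> simp [oddCoeff, slotIdx, hr]

/-- ★★★ **Criterion at every admissible spin**: when `v ≠ 0`, the identity at the root plaquette of an isthmus hole
root holds iff the slot observable `X = G_{D∖w}(w.side ℓ → w.side ℓ̄)` vanishes.
[cite: GlazmanManolescu2019, Lemma 2.1] [cite: DuminilCopinSmirnov2012, proof of Lemma 1] -/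
theorem vertexFunctional_isthmus_root_eq_zero_iff_slot_of_pow_sixteen (h16 : t ^ 16 = -1) (hr : r ≠ 0)
    (hD : t ^ 6 * (1 + r ^ 4) - (1 + t ^ 12) * r ^ 2 ≠ 0) (hv : ybV (-1) t r ≠ 0) (Dl : List Face) (w : Face)
    (σ : Side) (hw : w ∈ Dl) (hh : nbr w σ ∉ dom Dl) (hO : OuterRoot (dom Dl) (w.side σ.opp)) :
    vertexFunctional (ybCurve (-1) t r) t (oddCoeff r) Dl (w.side σ) w = 0 ↔
      gmObservable (ybCurve (-1) t r) t (eraseFace Dl w) (w.side (lat σ)) (w.side (lat σ).opp) = 0 := by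
  have ht : t ≠ 0 := fun h => by rw [h] at h16; norm_num at h16
  rw [vertexFunctional_isthmus_root_eq_slot_of_pow_sixteen h16 hr hD Dl w σ hw hh hO]
  constructor
  · intro h
    rcases mul_eq_zero.1 h with h' | h'
    · exfalso
      refine (mul_ne_zero (mul_ne_zero (mul_ne_zero two_ne_zero hv) (oddCoeff_slotIdx_ne_zero hr σ.opp))
        (zpow_ne_zero _ ht)) h'
    · exact h'
  · intro h
    rw [h, mul_zero]

/-- **Named statement** («hole defect law at all admissible spins»): for every `t ∈ ℂ` with `t¹⁶ = −1`, every
`r ≠ 0` with `t⁶(1 + r⁴) − (1 + t¹²)r² ≠ 0`, every finite face list `Dl`, every `w ∈ Dl` and every side `σ` with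
the plaquette across `σ` missing and `w.side σ.opp` an outer root, the vertex functional of the weights
`ybCurve (−1) t r` with coefficients `(1, r, −1, −r)` at the root plaquette equals
`2·v·c_{σ̄}·t^{−4q}·G_{D∖w}(w.side ℓ → w.side ℓ̄)`. [cite: Glazman2015WeightedSAW, Lemma 3.1 (the σ = ℓ/8 families)] [cite: GlazmanManolescu2019, Lemma 2.1] -/
def _root_.Literature.Barriers.CriticalPhenomena.PlaquetteWalkIsthmusDefectAllSpins : Prop :=
  ∀ t : ℂ, t ^ 16 = -1 → ∀ r : ℂ, r ≠ 0 → t ^ 6 * (1 + r ^ 4) - (1 + t ^ 12) * r ^ 2 ≠ 0 →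
    ∀ (Dl : List Face) (w : Face) (σ : Side), w ∈ Dl → nbr w σ ∉ dom Dl → OuterRoot (dom Dl) (w.side σ.opp) →
      vertexFunctional (ybCurve (-1) t r) t (oddCoeff r) Dl (w.side σ) w =
        2 * ybV (-1) t r * oddCoeff r (slotIdx σ.opp) * t ^ (-(4 : ℤ) * qTurn σ (lat σ)) *
          gmObservable (ybCurve (-1) t r) t (eraseFace Dl w) (w.side (lat σ)) (w.side (lat σ).opp)

/-- The all-spins hole defect law holds. [cite: Glazman2015WeightedSAW, Lemma 3.1] [cite: GlazmanManolescu2019, Lemma 2.1] -/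
theorem _root_.Literature.Barriers.CriticalPhenomena.PlaquetteWalkIsthmusDefectAllSpins_holds :
    PlaquetteWalkIsthmusDefectAllSpins :=
  fun _ h16 _ hr hD Dl w σ hw hh hO => vertexFunctional_isthmus_root_eq_slot_of_pow_sixteen h16 hr hD Dl w σ hw hh hO

/-- Consistency: at the printed spin `t = e^{−5iπ/16}` this is Part 3d's `vertexFunctional_ybCurve_isthmus_root_eq_slot`.
[cite: GlazmanManolescu2019, Lemma 2.1] -/
example {r : ℂ} (hr : r ≠ 0) (hD : tFiveEighths ^ 6 * (1 + r ^ 4) - (1 + tFiveEighths ^ 12) * r ^ 2 ≠ 0)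
    (Dl : List Face) (w : Face) (σ : Side) (hw : w ∈ Dl) (hh : nbr w σ ∉ dom Dl)
    (hO : OuterRoot (dom Dl) (w.side σ.opp)) :
    vertexFunctional (ybCurve (-1) tFiveEighths r) tFiveEighths (oddCoeff r) Dl (w.side σ) w =
      2 * ybV (-1) tFiveEighths r * oddCoeff r (slotIdx σ.opp) * tFiveEighths ^ (-(4 : ℤ) * qTurn σ (lat σ)) *
        gmObservable (ybCurve (-1) tFiveEighths r) tFiveEighths (eraseFace Dl w) (w.side (lat σ)) (w.side (lat σ).opp) :=
  PlaquetteWalkIsthmusDefectAllSpins_holds _ tFiveEighths_pow_sixteen _ hr hD Dl w σ hw hh hO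

end AllSpinsUnconditional

end Literature.Barriers.CriticalPhenomena.PlaquetteWalk
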